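import Mathlib
import Summits.KontsevichZagierPeriods.Zeta5Search.Families.BasicGrowthTransport
import HarnessLib

/-!
# ζ(5) search — Families: weak capacity duality — `M_σ ≤ e^{−H(B)}` for every doubly stochastic `B` on the span pattern

HONEST FRAMING: systematic search; no irrationality claim unless certified.  STRUCTURAL facts about the size of Brown's
basic cellular integrals [Brown2016, §1.5 (1.3)–(1.4)] (seat P2, Families layer); nothing about the arithmetic of any
zeta value.

`Families/BasicGrowthTransport.lean` proved the INTEGER transport certificate `M_σ^q q^{q(ℓ+1)} ≤ ∏ p^p` and recorded,
without asserting it, the duality `1/M_σ = cap(S_σ) = exp(max_B H(B))` over doubly stochastic `B` supported on the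
edge–gap interval pattern `S_σ`.  This file proves the WEAK half of that duality in full generality (real plans):

* **`fSigma_le_of_realTransport`**, **`fSup_le_of_realTransport`** — for a bijective seating and any REAL plan
  `x ≥ 0` supported on (finite `σδ⁰`-edge position, spanned gap) with row sums `1` on the finite edges and column sums `1`:
  **`f_σ ≤ ∏_{i,w} x(i,w)^{x(i,w)}`** on the open simplex, hence **`M_σ ≤ ∏ x^x`** (weighted AM–GM edge by edge:
  `len_e ≥ ∏_w (g_w/x_{ew})^{x_{ew}}`);
* **`fSup_le_exp_sum_mul_log`** — the same bound in entropy form, **`M_σ ≤ exp(Σ_{i,w} x log x) = e^{−H(x)}`**.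
So `log(1/M_σ) ≥ H(B)` for every admissible `B` (weak duality); equality at the Sinkhorn scaling is the numerical
finding of `HOME/pub-zeta5-p2/g4/` (`φ^{-5}`, `(√2−1)^4`, `|μ₂|/4`, `λ₁`), not asserted.  The integer certificates of
`BasicGrowthTransport` / `RayGrowthTransport` are the rational points `x = p/q` of this statement.
Standard axioms only.
-/

noncomputable section

open MeasureTheory Set Finset Filter Topology

namespace Summit.KontsevichZagierPeriods.Zeta5Search.Families.Cellular

variable {ℓ : ℕ} (σ : Fin (ℓ + 3) → Fin (ℓ + 3))

/-- **Weak capacity duality, pointwise.**  For a bijective seating and a real transport plan `x ≥ 0` supported on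
(finite edge position, spanned gap) with row sums `1` on the finite edges and column sums `1`:
`f_σ(t) ≤ ∏_{i,w} x(i,w)^{x(i,w)}` on the open simplex. -/
theorem fSigma_le_of_realTransport (hσ : Function.Bijective σ) (x : Fin (ℓ + 3) → Fin (ℓ + 1) → ℝ)
    (hx : ∀ i w, 0 ≤ x i w)
    (hsupp : ∀ i w, x i w ≠ 0 → ((σ i).val ≠ ℓ + 2 ∧ (σ (i + 1)).val ≠ ℓ + 2) ∧
      min (σ i).val (σ (i + 1)).val ≤ w.val ∧ w.val < max (σ i).val (σ (i + 1)).val)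
    (hrow : ∀ i, ((σ i).val ≠ ℓ + 2 ∧ (σ (i + 1)).val ≠ ℓ + 2) → ∑ w, x i w = 1)
    (hcol : ∀ w, ∑ i, x i w = 1) {t : Fin ℓ → ℝ} (ht : t ∈ openSimplex ℓ) :
    fSigma σ t ≤ ∏ i, ∏ w, x i w ^ x i w := by
  classical
  have hpos := (mem_openSimplex_iff_gapN t).1 ht
  set L : Fin (ℓ + 3) → ℝ := fun i => ef t (σ i) (σ (i + 1)) with hL
  have hLpos : ∀ i, 0 < L i := fun i => ef_pos ht fun h => succ_ne_self i (hσ.1 h)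
  have hden : formDen σ t = ∏ i, L i := rfl
  have hxx : ∀ i w, 0 ≤ x i w ^ x i w := fun i w => Real.rpow_nonneg (hx i w) _
  -- per position: `∏_w g_w^{x(i,w)} ≤ L_i · ∏_w x^x`
  have hstep : ∀ i, ∏ w : Fin (ℓ + 1), gapN t w ^ x i w ≤ L i * ∏ w, x i w ^ x i w := by
    intro i
    set s := univ.filter fun w : Fin (ℓ + 1) => x i w ≠ 0 with hs
    have hmem : ∀ w, w ∈ s ↔ x i w ≠ 0 := fun w => by simp [hs]
    -- outside the support both factors are `1`
    have h1 : ∏ w ∈ s, gapN t w ^ x i w = ∏ w : Fin (ℓ + 1), gapN t w ^ x i w := by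
      refine Finset.prod_subset (Finset.filter_subset _ _) fun w _ hw => ?_
      have : x i w = 0 := by by_contra h; exact hw ((hmem w).2 h)
      rw [this, Real.rpow_zero]
    have h2 : ∏ w ∈ s, x i w ^ x i w = ∏ w, x i w ^ x i w := by
      refine Finset.prod_subset (Finset.filter_subset _ _) fun w _ hw => ?_
      have : x i w = 0 := by by_contra h; exact hw ((hmem w).2 h)
      rw [this, Real.rpow_zero]
    rcases s.eq_empty_or_nonempty with hse | hsne
    · -- empty support: a finite edge has row sum `1`, so the edge at `i` passes through `∞` and `L i = 1`
      have h0 : ∀ w, x i w = 0 := fun w => by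
        by_contra h
        have : w ∈ s := (hmem w).2 h
        rw [hse] at this
        exact Finset.notMem_empty w this
      have hinf : ¬ ((σ i).val ≠ ℓ + 2 ∧ (σ (i + 1)).val ≠ ℓ + 2) := by
        intro hfin
        have := hrow i hfin
        simp [h0] at this
      have hLi : L i = 1 := by
        simp only [hL]
        exact ef_sigma_of_infinite σ t i hinf
      rw [← h1, ← h2, hse, Finset.prod_empty, Finset.prod_empty, mul_one, hLi]
    · obtain ⟨w0, hw0⟩ := hsne
      have hfin := (hsupp i w0 ((hmem w0).1 hw0)).1
      have hxpos : ∀ w ∈ s, 0 < x i w := fun w hw => lt_of_le_of_ne (hx i w) (Ne.symm ((hmem w).1 hw))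
      -- weighted AM–GM on the support with weights `x(i,·)` at the points `g_w / x(i,w)`
      have hw' : ∑ w ∈ s, x i w = 1 := by rw [hs, Finset.sum_filter_ne_zero]; exact hrow i hfin
      have amgm := Real.geom_mean_le_arith_mean_weighted s (x i) (fun w => gapN t w / x i w)
        (fun w hw => (hxpos w hw).le) hw' (fun w hw => div_nonneg (hpos w).le (hx i w))
      have hR : ∑ w ∈ s, x i w * (gapN t w / x i w) = ∑ w ∈ s, gapN t w := by
        refine Finset.sum_congr rfl fun w hw => ?_
        rw [mul_div_cancel₀ _ (hxpos w hw).ne']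
      have hLhs : ∏ w ∈ s, (gapN t w / x i w) ^ x i w = (∏ w ∈ s, gapN t w ^ x i w) / ∏ w ∈ s, x i w ^ x i w := by
        rw [← Finset.prod_div_distrib]
        refine Finset.prod_congr rfl fun w hw => ?_
        rw [Real.div_rpow (hpos w).le (hx i w)]
      rw [hR, hLhs, div_le_iff₀ (Finset.prod_pos fun w hw => Real.rpow_pos_of_pos (hxpos w hw) _)] at amgm
      -- the supported gaps lie in the span of the (finite) edge
      have h3 : ∑ w ∈ s, gapN t w ≤ L i := by
        have hlen : L i = (cellEdges σ hσ.1).len t (Sum.inr ⟨i, hfin⟩) := by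
          simp only [hL, ef_sigma_of_finite σ t i hfin]
          rfl
        rw [hlen, (cellEdges σ hσ.1).len_eq_sum_gap]
        refine Finset.sum_le_sum_of_subset_of_nonneg (fun w hw => ?_) fun w _ _ => (hpos w).le
        have hw' : x i w ≠ 0 := (hmem w).1 hw
        rw [EdgeFamily.mem_span]
        simp only [cellEdges, Sum.elim_inr]
        exact (hsupp i w hw').2
      rw [← h1, ← h2]
      exact amgm.trans (mul_le_mul_of_nonneg_right h3 (Finset.prod_nonneg fun w _ => hxx i w))
  -- multiply over the positions
  have hprod := Finset.prod_le_prod (s := (univ : Finset (Fin (ℓ + 3))))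
    (fun i _ => Finset.prod_nonneg fun w _ => Real.rpow_nonneg (hpos w).le _) fun i _ => hstep i
  rw [Finset.prod_mul_distrib] at hprod
  -- `∏_i ∏_w g_w^{x(i,w)} = ∏_w g_w`
  have hnum : ∏ i, ∏ w : Fin (ℓ + 1), gapN t w ^ x i w = ∏ w : Fin (ℓ + 1), gapN t w := by
    rw [Finset.prod_comm]
    refine Finset.prod_congr rfl fun w _ => ?_
    rw [← Real.rpow_sum_of_pos (hpos w), hcol w, Real.rpow_one]
  rw [hnum, ← hden] at hprod
  have hden0 : 0 < formDen σ t := by rw [hden]; exact Finset.prod_pos fun i _ => hLpos i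
  unfold fSigma
  rw [prod_ef_succ_eq_prod_gapN, div_le_iff₀ hden0, mul_comm]
  exact hprod

/-- **Weak capacity duality: `M_σ ≤ ∏_{i,w} x(i,w)^{x(i,w)}`** for every real plan as in `fSigma_le_of_realTransport`. -/
theorem fSup_le_of_realTransport (hσ : Function.Bijective σ) (x : Fin (ℓ + 3) → Fin (ℓ + 1) → ℝ)
    (hx : ∀ i w, 0 ≤ x i w)
    (hsupp : ∀ i w, x i w ≠ 0 → ((σ i).val ≠ ℓ + 2 ∧ (σ (i + 1)).val ≠ ℓ + 2) ∧
      min (σ i).val (σ (i + 1)).val ≤ w.val ∧ w.val < max (σ i).val (σ (i + 1)).val)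
    (hrow : ∀ i, ((σ i).val ≠ ℓ + 2 ∧ (σ (i + 1)).val ≠ ℓ + 2) → ∑ w, x i w = 1)
    (hcol : ∀ w, ∑ i, x i w = 1) :
    fSup σ ≤ ∏ i, ∏ w, x i w ^ x i w :=
  fSup_le_of_forall_le σ fun _ ht => fSigma_le_of_realTransport σ hσ x hx hsupp hrow hcol ht

/-- `x^x = exp(x log x)` for `x ≥ 0` (with `0^0 = 1 = exp 0`). -/
theorem rpow_self_eq_exp_mul_log {x : ℝ} (hx : 0 ≤ x) : x ^ x = Real.exp (x * Real.log x) := by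
  rcases hx.eq_or_lt with h | h
  · rw [← h, Real.rpow_zero, zero_mul, Real.exp_zero]
  · rw [Real.rpow_def_of_pos h, mul_comm]

/-- **Entropy form: `M_σ ≤ exp(Σ_{i,w} x log x) = e^{−H(x)}`** — `log(1/M_σ)` is at least the entropy of every doubly
stochastic matrix supported on the edge–gap interval pattern (weak half of the capacity duality). -/
theorem fSup_le_exp_sum_mul_log (hσ : Function.Bijective σ) (x : Fin (ℓ + 3) → Fin (ℓ + 1) → ℝ)
    (hx : ∀ i w, 0 ≤ x i w)
    (hsupp : ∀ i w, x i w ≠ 0 → ((σ i).val ≠ ℓ + 2 ∧ (σ (i + 1)).val ≠ ℓ + 2) ∧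
      min (σ i).val (σ (i + 1)).val ≤ w.val ∧ w.val < max (σ i).val (σ (i + 1)).val)
    (hrow : ∀ i, ((σ i).val ≠ ℓ + 2 ∧ (σ (i + 1)).val ≠ ℓ + 2) → ∑ w, x i w = 1)
    (hcol : ∀ w, ∑ i, x i w = 1) :
    fSup σ ≤ Real.exp (∑ i, ∑ w, x i w * Real.log (x i w)) := by
  rw [Real.exp_sum]
  refine (fSup_le_of_realTransport σ hσ x hx hsupp hrow hcol).trans (le_of_eq ?_)
  refine Finset.prod_congr rfl fun i _ => ?_
  rw [Real.exp_sum]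
  exact Finset.prod_congr rfl fun w _ => rpow_self_eq_exp_mul_log (hx i w)

end Summit.KontsevichZagierPeriods.Zeta5Search.Families.Cellular
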